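import Summits.Ventures.YMGap.Census.TwoDimExactRows
import Summits.Ventures.YMGap.Census.PatternMonotone
import HarnessLib

/-!
# Venture YMGap, track (b) — the potential-moving (MK) decimation is EXACT in two dimensions: III.1, III.2,
# the MK–Tomboulis vortex inequality (5.22) and the «common interpolation parameter» on `(ℤ/L)²`

HONEST FRAMING: venture file of the cell `pub-ymgap` (QuantumFields programme), track (b); census catalogue
rows C3, C4, C6/(5.22) and C7/V.1 (cell file `lit/LIT2-TOMBOULIS-ITOSEILER.md` §E) in the one dimension where
everything is an identity between finite sums.  With `ζ = b^{d−2} = 1` Tomboulis's decimated coefficients are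
`c^U_j = c_j^{b²}` and `F_0^U = 1` (Migdal's recursion is exact on the 2-torus), so — for every `L ≥ 1`, scale
`b`, cut-off `J` and admissible `c`:

* `mkFhat_one`, `mkCoeff_one_of_mem`, `mkF0_one` — `F̂_0 = 1`, `F̂_j = c_j` (`1 ≤ 2j ≤ J`), `c^U_j(1) = c_j^{b²}`;
* `torusZ_two_decimation` — `Z_{(ℤ/bL)²}({c_j}) = Z_{(ℤ/L)²}({c_j^{b²}})` EXACTLY, hence
  `decimationUpperBound_two : DecimationUpperBound 2 L b J 1` (III.1 (3.4), with equality);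
* `decimationLowerBound_two_two : DecimationLowerBound 2 L 2 J` (III.2 (3.7) with `c^L = c⁶`, scale `b = 2`:
  `c^{6L²} ≤ c^{4L²}`), and `not_decimationLowerBound_two_of_three_le` (for `b ≥ 3` the typed (3.7) FAILS in
  `d = 2`: `6 < b²`);
* `vortexRatio_two_decimation` — `Z⁻/Z` is decimation-invariant in `d = 2`, hence
  `mktLowerBound_two : MKTLowerBound L b J 1 0 1 _` ((5.22), with equality);
* **`not_commonInterpolation_two`** — the typed `CommonInterpolation` asks for a common `α* ∈ (0,1)` (OPEN
  interval, as in T07's construction, where `α_{Λ,h}(t) < 1` whenever the III.1 upper bound is strict, i.e. in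
  `d ≥ 3`); in `d = 2` the matching parameter is `α* = 1` exactly (`commonInterpolation_two_at_one` — Ito–Seiler's
  printed Claim 2.1, «there exist `t ≥ 0` such that `1 + Z⁻_Λ/Z_Λ = 1 + Z⁻_{Λ^{(1)}}({α(t)c})/Z_{Λ^{(1)}}({α(t)c})`»,
  holds there trivially with `α(t) ≡ 1`), and by the strict monotonicity of `α ↦ Z⁻/Z`
  (`vortexRatio_two_strictAntiOn`) NO `α* ∈ (0,1)` exists as soon as some half-integer spin is switched on — the
  typed open-interval form is FALSE on every 2-torus exactly when it has content (and trivially true, with every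
  `α`, when all half-integer `c_j` vanish: `Z⁻ = Z`).

References: E. T. Tomboulis, arXiv:0707.2179 §§2–3, 5 [cite: Tomboulis2007Confinement, §2 (2.19)–(2.22), §3 (3.4), (3.7),
§5 (5.16)–(5.18), (5.22)]; K. R. Ito, E. Seiler, arXiv:0711.4930 §2 Claim 2.1 [cite: ItoSeiler2007Tomboulis, §2 Claim 2.1];
A. A. Migdal, Sov. Phys. JETP 42 (1975) 413 (recursion exact in `d = 2`) [folklore].
-/

noncomputable section

open MeasureTheory Finset Real Function Polynomial.Chebyshev
open scoped BigOperators
open Literature.MathematicalPhysics.QuantumLattice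
open Literature.MathematicalPhysics.QuantumFieldTheory
open Literature.MathematicalPhysics.QuantumFieldTheory.Tomboulis2007
open Summit.Ventures.LatticeQCDFlow.Exactness
open Summit.Ventures.LatticeQCDFlow.Scoring

namespace Summit.Ventures.YMGap.Census

/-! ### The one-plaquette character coefficients `F̂_j` at `ζ = 1` -/

/-- `χ_n(U) = U_n(a₀(U))` (the census character is the pub-lqcd character; definitional). -/
theorem su2Char_eq_eval_su2a0 (n : ℕ) (g : SU2) : su2Char n g = (U ℝ n).eval (su2a0 g) := rfl

/-- `∫ χ_n dHaar = [n = 0]` (orthonormality against `χ_0 = 1`). -/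
theorem integral_su2Char_single (n : ℕ) :
    ∫ g, (U ℝ n).eval (su2a0 g) ∂(haarProbability SU2) = if n = 0 then 1 else 0 := by
  have h := integral_su2Character_mul_su2Character 0 n
  have h1 : ∀ g : SU2, (U ℝ (0 : ℕ)).eval (su2a0 g) * (U ℝ n).eval (su2a0 g) = (U ℝ n).eval (su2a0 g) := by
    intro g
    simp
  simp_rw [h1] at h
  by_cases hn : n = 0
  · subst hn
    rw [if_pos rfl] at h ⊢
    exact h
  · rw [if_neg hn]
    rw [if_neg (Ne.symm hn)] at h
    exact h

/-- **`F̂_j` at `ζ = 1`** (arXiv:0707.2179 (2.22) with `ζ = b^{d−2} = 1`, i.e. `d = 2`): by Haar orthonormality of the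
characters, `F̂_0 = 1`, `F̂_j = c_j` for `1 ≤ 2j ≤ J`, and `F̂_j = 0` beyond the cut-off. -/
theorem mkFhat_one (J : ℕ) (c : ℕ → ℝ) (n : ℕ) :
    mkFhat J c 1 n = if n = 0 then 1 else if n ∈ Icc 1 J then c n else 0 := by
  unfold mkFhat plaqFn
  simp_rw [pow_one, su2Char_eq_eval_su2a0]
  have hχ : ∀ m : ℕ, Integrable (fun g : SU2 => (U ℝ m).eval (su2a0 g) * (U ℝ n).eval (su2a0 g))
      (haarProbability SU2) := fun m =>
    ((continuous_su2Character_comp m continuous_id).mul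
      (continuous_su2Character_comp n continuous_id)).integrable_of_hasCompactSupport
      (HasCompactSupport.of_compactSpace _)
  have hχn : Integrable (fun g : SU2 => (U ℝ n).eval (su2a0 g)) (haarProbability SU2) :=
    (continuous_su2Character_comp n continuous_id).integrable_of_hasCompactSupport
      (HasCompactSupport.of_compactSpace _)
  -- rewrite the integrand as a combination of characters and character products
  have hpt : ∀ g : SU2, (1 + ∑ m ∈ Icc 1 J, ((m : ℝ) + 1) * c m * (U ℝ m).eval (su2a0 g)) *
      ((U ℝ n).eval (su2a0 g) / ((n : ℝ) + 1)) =
      ((n : ℝ) + 1)⁻¹ * (U ℝ n).eval (su2a0 g) +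
        ∑ m ∈ Icc 1 J, (((m : ℝ) + 1) * c m / ((n : ℝ) + 1)) *
          ((U ℝ m).eval (su2a0 g) * (U ℝ n).eval (su2a0 g)) := by
    intro g
    rw [add_mul, Finset.sum_mul]
    congr 1
    · ring
    · refine Finset.sum_congr rfl fun m _ => ?_
      ring
  simp_rw [hpt]
  rw [integral_add (hχn.const_mul _) (integrable_finsetSum _ fun m _ => (hχ m).const_mul _),
    integral_const_mul, integral_finsetSum _ (fun m _ => (hχ m).const_mul _), integral_su2Char_single]
  simp_rw [integral_const_mul, integral_su2Character_mul_su2Character]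
  have hn1 : ((n : ℝ) + 1) ≠ 0 := by positivity
  by_cases hn : n = 0
  · subst hn
    rw [if_pos rfl, if_pos rfl]
    rw [Finset.sum_eq_zero fun m hm => by
      have : m ≠ 0 := by have := (Finset.mem_Icc.1 hm).1; omega
      rw [if_neg this, mul_zero]]
    simp
  · rw [if_neg hn, mul_zero, zero_add, if_neg hn]
    by_cases hmem : n ∈ Icc 1 J
    · rw [if_pos hmem, Finset.sum_eq_single n (fun m _ hmn => by rw [if_neg hmn, mul_zero])
        (fun h => absurd hmem h), if_pos rfl, mul_one]
      field_simp
    · rw [if_neg hmem]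
      exact Finset.sum_eq_zero fun m hm => by
        have hmn : m ≠ n := fun h => hmem (h ▸ hm)
        rw [if_neg hmn, mul_zero]

/-- `F̂_0 = 1` at `ζ = 1`. -/
theorem mkFhat_one_zero (J : ℕ) (c : ℕ → ℝ) : mkFhat J c 1 0 = 1 := by
  rw [mkFhat_one, if_pos rfl]

/-- **The bulk factor is trivial in two dimensions**: `F_0^U = F̂_0^{b²} = 1`. -/
theorem mkF0_one (J : ℕ) (c : ℕ → ℝ) (b : ℕ) : mkF0 J c 1 b = 1 := by
  unfold mkF0
  rw [mkFhat_one_zero, one_pow]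

/-- **The decimated coefficients in two dimensions**: `c^U_j = c_j^{b²}` for `1 ≤ 2j ≤ J` and admissible `c` (`r = 1`). -/
theorem mkCoeff_one_of_mem (J : ℕ) (c : ℕ → ℝ) (b : ℕ) {n : ℕ} (hn : n ∈ Icc 1 J) :
    mkCoeff J c 1 b 1 n = c n ^ (b ^ 2) := by
  unfold mkCoeff
  have hn0 : n ≠ 0 := by have := (Finset.mem_Icc.1 hn).1; omega
  rw [mkFhat_one_zero, div_one, mkFhat_one, if_neg hn0, if_pos hn, mul_one,
    show ((b : ℝ) ^ 2) = ((b ^ 2 : ℕ) : ℝ) by push_cast; ring, Real.rpow_natCast]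

/-- The decimated coefficients of an admissible vector are admissible (`0 ≤ c_j^{b²} ≤ 1`; `0` beyond the cut-off). -/
theorem coeffAdmissible_mkCoeff_one (J : ℕ) {c : ℕ → ℝ} (hc : CoeffAdmissible c) (b : ℕ) [NeZero b] :
    CoeffAdmissible (mkCoeff J c 1 b 1) := by
  intro n hn1
  by_cases hn : n ∈ Icc 1 J
  · rw [mkCoeff_one_of_mem J c b hn]
    exact ⟨pow_nonneg (hc n hn1).1 _, pow_le_one₀ (hc n hn1).1 (hc n hn1).2⟩
  · unfold mkCoeff
    have hn0 : n ≠ 0 := by omega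
    rw [mkFhat_one_zero, div_one, mkFhat_one, if_neg hn0, if_neg hn, mul_one,
      Real.zero_rpow (pow_ne_zero 2 (by exact_mod_cast NeZero.ne b))]
    exact ⟨le_rfl, zero_le_one⟩

variable {L : ℕ} [NeZero L]

/-! ### III.1 and III.2 in two dimensions -/

/-- The coarse cut-off `b^{d−2}·J` is `J` in `d = 2`. -/
theorem pow_sub_self_two_mul (b J : ℕ) : b ^ (2 - 2) * J = J := by simp

/-- **Migdal's recursion is exact on the 2-torus**: `Z_{(ℤ/bL)²}({c_j}) = Z_{(ℤ/L)²}({c^U_j})`, `c^U_j = c_j^{b²}`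
(admissible `c`, `r = 1`). -/
theorem torusZ_two_decimation (b : ℕ) [NeZero (b * L)] (J : ℕ) (c : ℕ → ℝ) :
    torusZ 2 (b * L) J c = torusZ 2 L (b ^ (2 - 2) * J) (mkCoeff J c (b ^ (2 - 2)) b 1) := by
  rw [pow_sub_self_two_mul, pow_zero, torusZ_two, torusZ_two]
  congr 1
  refine Finset.sum_congr rfl fun n hn => ?_
  rw [mkCoeff_one_of_mem J c b hn, ← pow_mul, mul_pow]

/-- **III.1 (3.4) in two dimensions, with equality** (`F_0^U = 1`): `DecimationUpperBound 2 L b J 1` for every `L`, `b`, `J`. -/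
theorem decimationUpperBound_two (b : ℕ) [NeZero (b * L)] (J : ℕ) : DecimationUpperBound 2 L b J 1 := by
  intro c hc
  rw [torusZ_two_decimation b J c, pow_zero, mkF0_one, one_pow]
  simp only [one_mul, le_refl]

/-- **III.2 (3.7) in two dimensions at scale `b = 2`**: `Z_{(ℤ/L)²}({c_j⁶}) ≤ Z_{(ℤ/2L)²}({c_j})`, i.e.
`c_j^{6L²} ≤ c_j^{4L²}` termwise for `0 ≤ c_j ≤ 1`. -/
theorem decimationLowerBound_two_two [NeZero (2 * L)] (J : ℕ) : DecimationLowerBound 2 L 2 J := by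
  intro c hc
  rw [torusZ_two, torusZ_two]
  refine add_le_add le_rfl (Finset.sum_le_sum fun n hn => ?_)
  have h0 := (hc n (Finset.mem_Icc.1 hn).1).1
  have h1 := (hc n (Finset.mem_Icc.1 hn).1).2
  unfold lowerCoeff
  rw [← pow_mul, mul_pow, show (2 : ℕ) ^ 2 = 4 by norm_num]
  exact pow_le_pow_of_le_one h0 h1 (by nlinarith [Nat.one_le_iff_ne_zero.2 (pow_ne_zero 2 (NeZero.ne L))])

/-- For scales `b ≥ 3` the typed III.2 (3.7) (lower coefficients `c⁶`, independent of `b`) FAILS in two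
dimensions: with `c_{1/2} = 1/2` (other `c_j = 0`), `(1/2)^{6L²} > (1/2)^{b²L²}` since `6 < b²`. -/
theorem not_decimationLowerBound_two_of_three_le {b : ℕ} [NeZero (b * L)] (hb : 3 ≤ b) {J : ℕ} (hJ : 1 ≤ J) :
    ¬ DecimationLowerBound 2 L b J := by
  intro h
  have hc : CoeffAdmissible (fun n => if n = 1 then (1 / 2 : ℝ) else 0) := by
    intro n _
    by_cases hn : n = 1
    · simp only [if_pos hn]; norm_num
    · simp only [if_neg hn]; norm_num
  have hle := h _ hc
  rw [torusZ_two, torusZ_two, add_le_add_iff_left] at hle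
  have h1 : (1 : ℕ) ∈ Icc 1 J := Finset.mem_Icc.2 ⟨le_rfl, hJ⟩
  rw [Finset.sum_eq_single 1 (fun n _ hn => by simp [lowerCoeff, hn, zero_pow (pow_ne_zero 2 (NeZero.ne L))])
      (fun h' => absurd h1 h'),
    Finset.sum_eq_single 1 (fun n _ hn => by
        simp [hn, zero_pow (pow_ne_zero 2 (NeZero.ne (b * L)))])
      (fun h' => absurd h1 h')] at hle
  simp only [lowerCoeff] at hle
  rw [← pow_mul, mul_pow] at hle
  -- `(1/2)^{6 L²} ≤ (1/2)^{b² L²}` contradicts `6 L² < b² L²`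
  have hL : 1 ≤ L ^ 2 := Nat.one_le_iff_ne_zero.2 (pow_ne_zero 2 (NeZero.ne L))
  have hb2 : 9 ≤ b ^ 2 := by nlinarith
  have hlt : 6 * L ^ 2 < b ^ 2 * L ^ 2 := by nlinarith
  have hstrict : (1 / 2 : ℝ) ^ (b ^ 2 * L ^ 2) < (1 / 2 : ℝ) ^ (6 * L ^ 2) :=
    pow_lt_pow_right_of_lt_one₀ (by norm_num) (by norm_num) hlt
  exact absurd hle (not_le.2 hstrict)

/-! ### (5.22) and the common interpolation parameter in two dimensions -/

/-- **`Z⁻/Z` is decimation-invariant on the 2-torus**: the vortex free-energy ratio of `(ℤ/bL)²` at `{c_j}` equals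
that of `(ℤ/L)²` at the decimated coefficients `{c_j^{b²}}` (admissible `c`, `r = 1`). -/
theorem vortexRatio_two_decimation (b : ℕ) [NeZero (b * L)] (J : ℕ) (c : ℕ → ℝ) (h01 : (0 : Fin 2) < 1) :
    vortexRatio 2 L (b ^ (2 - 2) * J) (mkCoeff J c (b ^ (2 - 2)) b 1) (vortexSheet L 0 1 h01) =
      vortexRatio 2 (b * L) J c (vortexSheet (b * L) 0 1 h01) := by
  unfold vortexRatio
  rw [← torusZ_two_decimation b J c, pow_sub_self_two_mul, pow_zero, torusZtw_two_vortexSheet,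
    torusZtw_two_vortexSheet]
  congr 2
  refine Finset.sum_congr rfl fun n hn => ?_
  rw [mkCoeff_one_of_mem J c b hn, ← pow_mul, mul_pow]

/-- **(5.22) in two dimensions, with equality**: `MKTLowerBound L b J 1 0 1` on `(ℤ/L)²` for every `L`, `b`, `J`. -/
theorem mktLowerBound_two (b : ℕ) [NeZero (b * L)] (J : ℕ) (h01 : (0 : Fin 2) < 1) :
    MKTLowerBound (d := 2) L b J 1 0 1 h01 := by
  intro c _
  rw [vortexRatio_two_decimation b J c h01]

/-- **The matching parameter is `α* = 1`** (closed interval): in `d = 2`,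
`Z⁻_{(ℤ/bL)²}/Z_{(ℤ/bL)²}({c_j}) = Z⁻_{(ℤ/L)²}/Z_{(ℤ/L)²}({1 · c^U_j})`. -/
theorem commonInterpolation_two_at_one (b : ℕ) [NeZero (b * L)] (J : ℕ) (c : ℕ → ℝ) (h01 : (0 : Fin 2) < 1) :
    vortexRatio 2 (b * L) J c (vortexSheet (b * L) 0 1 h01) =
      vortexRatio 2 L (b ^ (2 - 2) * J) (scaleCoeff 1 (mkCoeff J c (b ^ (2 - 2)) b 1))
        (vortexSheet L 0 1 h01) := by
  rw [scaleCoeff_one, vortexRatio_two_decimation b J c h01]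

/-- **The typed (open-interval) common-interpolation claim fails in two dimensions whenever it has content.**
For admissible `c` with some half-integer spin switched on (`c_n > 0` for an odd `n ≤ J`), there is NO `α* ∈ (0,1)` with
`Z⁻_Λ/Z_Λ({c_j}) = Z⁻_{Λ^{(1)}}/Z_{Λ^{(1)}}({α* c^U_j})` on `Λ = (ℤ/bL)²`, `Λ^{(1)} = (ℤ/L)²`, `b ≥ 1`: the
coarse ratio is STRICTLY decreasing in `α` (`vortexRatio_two_strictAntiOn`) and matches exactly at `α = 1`. -/
theorem not_commonInterpolation_two (b : ℕ) [NeZero b] [NeZero (b * L)] (J : ℕ) {c : ℕ → ℝ}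
    (hc : CoeffAdmissible c) (hodd : ∃ n ∈ Icc 1 J, Odd n ∧ 0 < c n) (h01 : (0 : Fin 2) < 1) :
    ¬ CommonInterpolation (d := 2) L b J 1 0 1 h01 c := by
  rintro ⟨α, hα, hαeq⟩
  -- strict monotonicity of the coarse ratio at the (admissible) decimated coefficients
  have hcU : CoeffAdmissible (mkCoeff J c (b ^ (2 - 2)) b 1) := by
    rw [pow_zero]
    exact coeffAdmissible_mkCoeff_one J hc b
  have hoddU : ∃ n ∈ Icc 1 (b ^ (2 - 2) * J), Odd n ∧ 0 < mkCoeff J c (b ^ (2 - 2)) b 1 n := by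
    obtain ⟨n, hn, hno, hpos⟩ := hodd
    refine ⟨n, by rwa [pow_sub_self_two_mul], hno, ?_⟩
    rw [pow_zero, mkCoeff_one_of_mem J c b hn]
    exact pow_pos hpos _
  have hV : Odd (vortexSheet L (0 : Fin 2) 1 h01).card := by
    rw [card_vortexSheet_two h01]
    exact odd_one
  have hstrict := vortexRatio_two_strictAntiOn (L := L) (b ^ (2 - 2) * J) hcU (vortexSheet L 0 1 h01) hV hoddU
  have hlt : vortexRatio 2 L (b ^ (2 - 2) * J) (scaleCoeff 1 (mkCoeff J c (b ^ (2 - 2)) b 1))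
        (vortexSheet L 0 1 h01) <
      vortexRatio 2 L (b ^ (2 - 2) * J) (scaleCoeff α (mkCoeff J c (b ^ (2 - 2)) b 1))
        (vortexSheet L 0 1 h01) :=
    hstrict ⟨hα.1.le, hα.2.le⟩ ⟨zero_le_one, le_rfl⟩ hα.2
  -- but the two ratios agree at `α = 1`
  rw [← commonInterpolation_two_at_one b J c h01, hαeq] at hlt
  exact lt_irrefl _ hlt

/-- Conversely, when every half-integer spin is switched off (`c_n = 0` for odd `n ≤ J`), `Z⁻ = Z` on both
tori and EVERY `α` matches: the typed `CommonInterpolation` then holds trivially (witness `α = 1/2`). -/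
theorem commonInterpolation_two_of_even_support (b : ℕ) [NeZero b] [NeZero (b * L)] (J : ℕ) {c : ℕ → ℝ}
    (hc : CoeffAdmissible c) (heven : ∀ n ∈ Icc 1 J, Odd n → c n = 0) (h01 : (0 : Fin 2) < 1) :
    CommonInterpolation (d := 2) L b J 1 0 1 h01 c := by
  refine ⟨1 / 2, ⟨by norm_num, by norm_num⟩, ?_⟩
  -- both ratios equal `1`
  have hsign : ∀ (c' : ℕ → ℝ) (J' : ℕ), (∀ n ∈ Icc 1 J', Odd n → c' n = 0) → ∀ (M : ℕ), M ≠ 0 → ∀ α : ℝ,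
      ∑ n ∈ Icc 1 J', (-1 : ℝ) ^ (n * 1) * (scaleCoeff α c' n) ^ M = ∑ n ∈ Icc 1 J', (scaleCoeff α c' n) ^ M := by
    intro c' J' hc' M hM α
    refine Finset.sum_congr rfl fun n hn => ?_
    rcases Nat.even_or_odd n with he | ho
    · rw [mul_one, he.neg_one_pow, one_mul]
    · simp [scaleCoeff, hc' n hn ho, zero_pow hM]
  have hratio : ∀ (L' : ℕ) [NeZero L'] (c' : ℕ → ℝ) (J' : ℕ), (∀ n ∈ Icc 1 J', Odd n → c' n = 0) →
      CoeffAdmissible c' → ∀ α : ℝ, 0 ≤ α →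
      vortexRatio 2 L' J' (scaleCoeff α c') (vortexSheet L' 0 1 h01) = 1 := by
    intro L' _ c' J' hc' hadm α hα
    unfold vortexRatio
    rw [torusZtw_two_vortexSheet, torusZ_two]
    have h := hsign c' J' hc' (L' ^ 2) (pow_ne_zero 2 (NeZero.ne L')) α
    simp_rw [mul_one] at h
    rw [h]
    have hpos : 0 < 1 + ∑ n ∈ Icc 1 J', scaleCoeff α c' n ^ (L' ^ 2) := by
      have : 0 ≤ ∑ n ∈ Icc 1 J', scaleCoeff α c' n ^ (L' ^ 2) :=
        Finset.sum_nonneg fun n hn => pow_nonneg (mul_nonneg hα (hadm n (Finset.mem_Icc.1 hn).1).1) _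
      linarith
    exact div_self hpos.ne'
  have hcU : CoeffAdmissible (mkCoeff J c (b ^ (2 - 2)) b 1) := by
    rw [pow_zero]; exact coeffAdmissible_mkCoeff_one J hc b
  have hevenU : ∀ n ∈ Icc 1 (b ^ (2 - 2) * J), Odd n → mkCoeff J c (b ^ (2 - 2)) b 1 n = 0 := by
    intro n hn ho
    rw [pow_sub_self_two_mul] at hn
    rw [pow_zero, mkCoeff_one_of_mem J c b hn, heven n hn ho, zero_pow (pow_ne_zero 2 (NeZero.ne b))]
  rw [hratio L _ _ hevenU hcU (1 / 2) (by norm_num)]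
  have h1 := hratio (b * L) c J heven hc 1 zero_le_one
  rw [scaleCoeff_one] at h1
  exact h1

end Summit.Ventures.YMGap.Census
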